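import Literature.Geometry.Kaehler.RiemannSurfaceSeparating
import Mathlib.Analysis.Calculus.InverseFunctionTheorem.FDeriv
import Mathlib.Analysis.Calculus.Deriv.Inverse
import Mathlib.Analysis.Calculus.ContDiff.RCLike
import HarnessLib

/-!
# A holomorphic function with non-vanishing derivative is a local biholomorphism (Riemann surfaces)

Layer `Literature/Geometry/Kaehler`, sequel of `RiemannSurfaceSeparating` (chart transfer lemmas).
O. Forster, *Lectures on Riemann Surfaces*, GTM 81 (1981), §1 (Cor. 2.5 / the holomorphic inverse
function theorem in a chart): if `F : M → ℂ` on a Riemann surface has a chart expression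
`G = F ∘ φ⁻¹` holomorphic near `φ(x₀)` with `G'(φ(x₀)) ≠ 0`, then `F` restricts to a homeomorphism of
a neighbourhood of `x₀` onto an open subset of `ℂ` whose inverse is holomorphic:

* `exists_coe_eq_of_eqOn` — replacing the forward map of an open partial homeomorphism by a function
  agreeing with it on the source;
* `exists_localInverse_of_deriv_ne_zero` — **the local biholomorphism**: an open partial
  homeomorphism `e : M ⇀ ℂ` with `x₀ ∈ e.source`, `⇑e = F` and `e⁻¹` holomorphic on `e.target`
  (Mathlib's inverse function theorem `HasStrictFDerivAt.toOpenPartialHomeomorph` in the chart,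
  shrunk to where `G' ≠ 0`, and `OpenPartialHomeomorph.hasDerivAt_symm`).

Everything is proved; there are no definitions.

## References

* O. Forster, *Lectures on Riemann Surfaces*, GTM 81, Springer (1981), §1–§2 (Cor. 2.5).
  [Forster1981]
-/

noncomputable section

open scoped Manifold ContDiff Topology
open Set Filter Function Complex

namespace Literature.Geometry.Kaehler

namespace RiemannSurface

/-- **Replacing the forward map of an open partial homeomorphism** by a function agreeing with it on
the source (same source, target and inverse). [folklore] -/
theorem exists_coe_eq_of_eqOn {X Y : Type*} [TopologicalSpace X] [TopologicalSpace Y] (e : OpenPartialHomeomorph X Y)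
    {F : X → Y} (h : EqOn F e e.source) :
    ∃ e' : OpenPartialHomeomorph X Y, ⇑e' = F ∧ ⇑e'.symm = ⇑e.symm ∧ e'.source = e.source ∧ e'.target = e.target :=
  ⟨{ toFun := F, invFun := e.symm, source := e.source, target := e.target,
     map_source' := fun x hx ↦ by rw [h hx]; exact e.map_source hx,
     map_target' := fun y hy ↦ e.map_target hy,
     left_inv' := fun x hx ↦ by rw [h hx]; exact e.left_inv hx,
     right_inv' := fun y hy ↦ by rw [h (e.map_target hy)]; exact e.right_inv hy,
     open_source := e.open_source, open_target := e.open_target,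
     continuousOn_toFun := e.continuousOn.congr h,
     continuousOn_invFun := e.continuousOn_symm }, rfl, rfl, rfl, rfl⟩

variable {M : Type*} [TopologicalSpace M] [ChartedSpace ℂ M] [IsManifold 𝓘(ℂ, ℂ) ω M]

/-- **A holomorphic function with non-vanishing derivative is a local biholomorphism** (holomorphic
inverse function theorem on a Riemann surface): if the chart expression `G = F ∘ φ⁻¹` of `F : M → ℂ`
at `x₀` is holomorphic on an open neighbourhood `U₀ ⊆ φ.target` of `φ(x₀)` and `G'(φ(x₀)) ≠ 0`, there
is an open partial homeomorphism `e : M ⇀ ℂ` with `x₀ ∈ e.source`, `⇑e = F`, and `e⁻¹` holomorphic on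
`e.target`. [cite: Forster1981, §2 Cor. 2.5] -/
theorem exists_localInverse_of_deriv_ne_zero {F : M → ℂ} {x₀ : M} {U₀ : Set ℂ} (hU₀ : IsOpen U₀)
    (hx₀ : chartAt ℂ x₀ x₀ ∈ U₀) (hsub : U₀ ⊆ (chartAt ℂ x₀).target)
    (hG : DifferentiableOn ℂ (F ∘ (chartAt ℂ x₀).symm) U₀)
    (hG' : deriv (F ∘ (chartAt ℂ x₀).symm) (chartAt ℂ x₀ x₀) ≠ 0) :
    ∃ e : OpenPartialHomeomorph M ℂ, x₀ ∈ e.source ∧ ⇑e = F ∧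
      MDifferentiableOn 𝓘(ℂ, ℂ) 𝓘(ℂ, ℂ) e.symm e.target := by
  set φ := chartAt ℂ x₀ with hφ
  set G : ℂ → ℂ := F ∘ φ.symm with hGdef
  set z₀ : ℂ := φ x₀ with hz₀
  -- `G` is analytic on `U₀`, its derivative is continuous there
  have han : AnalyticOnNhd ℂ G U₀ := hG.analyticOnNhd hU₀
  have hcont : ContinuousOn (deriv G) U₀ := (han.deriv).continuousOn
  -- the open set where `G' ≠ 0`
  set V : Set ℂ := U₀ ∩ deriv G ⁻¹' {0}ᶜ with hV
  have hVopen : IsOpen V := hcont.isOpen_inter_preimage hU₀ isOpen_compl_singleton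
  have hz₀V : z₀ ∈ V := ⟨hx₀, hG'⟩
  -- the inverse function theorem at `z₀`
  have hstrict : HasStrictDerivAt G (deriv G z₀) z₀ :=
    ((han z₀ hx₀).contDiffAt (n := ω)).hasStrictDerivAt (by simp)
  set ψ₀ := (hstrict.hasStrictFDerivAt_equiv hG').toOpenPartialHomeomorph G with hψ₀
  have hψ₀coe : ⇑ψ₀ = G := HasStrictFDerivAt.toOpenPartialHomeomorph_coe _
  have hz₀ψ₀ : z₀ ∈ ψ₀.source := HasStrictFDerivAt.mem_toOpenPartialHomeomorph_source _
  -- shrink to `V`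
  set ψ := ψ₀.restrOpen V hVopen with hψ
  have hψcoe : ⇑ψ = G := by rw [hψ, OpenPartialHomeomorph.coe_restrOpen, hψ₀coe]
  have hψsource : ψ.source ⊆ V := by
    rw [hψ, OpenPartialHomeomorph.restrOpen_source]
    exact inter_subset_right
  have hz₀ψ : z₀ ∈ ψ.source := by
    rw [hψ, OpenPartialHomeomorph.restrOpen_source]
    exact ⟨hz₀ψ₀, hz₀V⟩
  -- the composite `φ ≫ ψ : M ⇀ ℂ` agrees with `F` on its source
  set e₀ := φ.trans ψ with he₀
  have hx₀e₀ : x₀ ∈ e₀.source := by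
    rw [he₀, OpenPartialHomeomorph.trans_source]
    exact ⟨mem_chart_source ℂ x₀, hz₀ψ⟩
  have heq : EqOn F e₀ e₀.source := by
    intro x hx
    rw [he₀, OpenPartialHomeomorph.trans_source] at hx
    simp only [he₀, OpenPartialHomeomorph.coe_trans, comp_apply, hψcoe, hGdef, φ.left_inv hx.1]
  obtain ⟨e, hecoe, hesymm, hesource, hetarget⟩ := exists_coe_eq_of_eqOn e₀ heq
  refine ⟨e, by rw [hesource]; exact hx₀e₀, hecoe, ?_⟩
  -- the inverse is holomorphic
  intro w hw
  rw [hetarget, he₀, OpenPartialHomeomorph.trans_target] at hw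
  obtain ⟨hwψ, hwφ⟩ := hw
  have hsw : ψ.symm w ∈ ψ.source := ψ.map_target hwψ
  have hswV : ψ.symm w ∈ V := hψsource hsw
  -- `ψ⁻¹` is differentiable at `w`
  have hGd : HasDerivAt G (deriv G (ψ.symm w)) (ψ.symm w) :=
    ((han _ hswV.1).differentiableAt).hasDerivAt
  have hψd : HasDerivAt ψ.symm (deriv G (ψ.symm w))⁻¹ w :=
    ψ.hasDerivAt_symm hwψ hswV.2 (by rw [hψcoe]; exact hGd)
  -- `φ⁻¹` is holomorphic at `ψ⁻¹ w`
  have hφd : MDifferentiableAt 𝓘(ℂ, ℂ) 𝓘(ℂ, ℂ) φ.symm (ψ.symm w) :=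
    mdifferentiableAt_atlas_symm (I := 𝓘(ℂ, ℂ)) (chart_mem_atlas ℂ x₀) (hsub hswV.1)
  have hcomp : MDifferentiableAt 𝓘(ℂ, ℂ) 𝓘(ℂ, ℂ) (φ.symm ∘ ψ.symm) w :=
    hφd.comp w hψd.differentiableAt.mdifferentiableAt
  have hsymm : ⇑e.symm = φ.symm ∘ ψ.symm := by
    rw [hesymm, he₀, OpenPartialHomeomorph.coe_trans_symm]
  rw [hsymm]
  exact hcomp.mdifferentiableWithinAt

end RiemannSurface

end Literature.Geometry.Kaehler
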